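import Summits.AtomisticToContinuum.Crystallization.Theorems.FrustratedLawDichotomyStrainedPatchHomEntryLeafHTX

/-!
# `entryLeafOKHT3`: the analytic-slab ξ-box leaf with the slope certificate CHUNKED (near / far₁ / far₂) — kernel-evaluable on the full `[−11,11]³` label set
# (27623 `(H) HomFloor (1/625)`, hcp half; critic rows 1108 (3) (iii) / 1110 (2))

decomp-a2c hand-1 g29 (crux `AperiodicFrustratedLawGap`, stmt-AtomisticToContinuum-27623).  KERNEL FINDING of this generation: every component of
`…HomEntryLeafHT.entryLeafOKHT` evaluates by `decide +kernel` at the gate cell in 65–220 s (label classification over `[−11,11]³`, `htCertOK`, `curvCheckLJM`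
on the near labels, `forceJacCheckN` on both far chunks, `htROK`) EXCEPT the single slope check `slopeCheckLJ` over all `≈ 1100` certainly-inside labels,
which dies in kernel evaluation (the `> 700`-label pathology hand-2 g29 reported).  Reference-force bounds ADD over disjoint label families, so this file
re-issues the leaf with the slope certificate split over the three chunks `htNear` / `htFar1` / `htFar2` (`≤ 400` labels each), the chunk constants computed
IN the kernel by `…HomSlopeLJ.slopeGsLJ` (no second pass) and only their SUM compared with the payload's `Gs`:

* §1 `htSl c w L` (slope split of a chunk on the reference box), `htNaiOK` (naive guard), `htGs` (computed chunk constant), `all_filter_self`,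
  ★ `refForce_chunk_le` (per-chunk reference force bound), ★ `refForce_htB_le` (`|Σ_B| ≤ (Σ_i htGs_i)/SC·‖Δ‖` over `B = htB`);
* §2 ★ `entryLeafOKHT3 μ p c w` and ★★★ `entryLeafOKHT3_sound` (hver shape; proof = `entryLeafOKHT_sound` with the chunked `hf₀`);
* §3 `entryLeafOKHT3X μ P` (∨ `entryLeafOKHCCX μ`), `entryLeafOKHT3X_sound`, ★★ `hcpHalf_of_entryTreeHT3X`, ★★★ `homFloor_625_of_entryTrees6RBKP_HT3X`.

Kernel definitions + soundness; 0 sorry; standard axioms; no instances / notation / `#eval`.  `--supports stmt-AtomisticToContinuum-27623`.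
-/

noncomputable section

namespace Summit.AtomisticToContinuum.Crystallization.Theorems.FrustratedLawDichotomyStrainedPatchHomEntryLeafHT

open scoped BigOperators RealInnerProductSpace
open Literature.Analysis.ValidatedNumerics.Numerics
open Summit.AtomisticToContinuum.Crystallization.Theorems.ChargedEnergyGapNegative (E3)
open Summit.AtomisticToContinuum.Crystallization.Theorems.FrustratedLawDichotomySchurCut (effPot w₄₅ ω₄)
open Summit.AtomisticToContinuum.Crystallization.Theorems.FrustratedLawDichotomyAveragingRuleTightFree (TightNearCap BadNearCap)
open Summit.AtomisticToContinuum.Crystallization.Theorems.FrustratedLawDichotomyExemptAbsorption (ExemptNear)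
open Summit.AtomisticToContinuum.Crystallization.Theorems.FrustratedLawDichotomyStrainedPatchHomSplit (ExRec latPt hexFrame hcpShift HomFloor)
open Summit.AtomisticToContinuum.Crystallization.Theorems.FrustratedLawDichotomyStrainedPatchTaylorChord (segGd)
open Summit.AtomisticToContinuum.Crystallization.Theorems.FrustratedLawDichotomyStrainedPatchHomEntryGram (entryFI mem_entryFI)
open Summit.AtomisticToContinuum.Crystallization.Theorems.FrustratedLawDichotomyStrainedPatchHomEntryGramHcp (dot3 shufFI mem_dot3 mem_shufFI)
open Summit.AtomisticToContinuum.Crystallization.Theorems.FrustratedLawDichotomyStrainedPatchHomForceKit (vecB mem_vecB)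
open Summit.AtomisticToContinuum.Crystallization.Theorems.FrustratedLawDichotomyStrainedPatchHomHertzKit (hertzTest quadForm_ge_of_hertzTest)
open Summit.AtomisticToContinuum.Crystallization.Theorems.FrustratedLawDichotomyStrainedPatchHomCurvCentreKit (cenShuf cenShuf_apply)
open Summit.AtomisticToContinuum.Crystallization.Theorems.FrustratedLawDichotomyStrainedPatchHomCurvLeaf
  (nodup_filter_append toFinset_filter_append)
open Summit.AtomisticToContinuum.Crystallization.Theorems.FrustratedLawDichotomyStrainedPatchHomCurvLeafL2 (refW)
open Summit.AtomisticToContinuum.Crystallization.Theorems.FrustratedLawDichotomyStrainedPatchHomCurvLJ (isCenLJ curvCheckLJM)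
open Summit.AtomisticToContinuum.Crystallization.Theorems.FrustratedLawDichotomyStrainedPatchHomForceJacN
  (fjQ fjVec fjE fjX forceJacCheckN boxLabels11 boxLabels11_toFinset boxLabels11_nodup)
open Summit.AtomisticToContinuum.Crystallization.Theorems.FrustratedLawDichotomyStrainedPatchHomSlopeLJ (slopeLJLabelOK slopeCheckLJ forceLJ_ref_bound_of_check)
open Summit.AtomisticToContinuum.Crystallization.Theorems.FrustratedLawDichotomyStrainedPatchHomForceHcp (xiBallOK norm_le_quarter_of_xiBallOK)
open Summit.AtomisticToContinuum.Crystallization.Theorems.FrustratedLawDichotomyStrainedPatchHomCurvLeafHCC (entryLeafOKHCCX entryLeafOKHCCX_sound)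
open Summit.AtomisticToContinuum.Crystallization.Theorems.FrustratedLawDichotomyStrainedPatchHomSlabConfine (abs_apply_le_of_qcert)
open Summit.AtomisticToContinuum.Crystallization.Theorems.FrustratedLawDichotomyStrainedPatchHomSlabLeaf
  (jac_floorM_of_three_checks abs_coord_le_of_confined hver_of_slabParts)
open Summit.AtomisticToContinuum.Crystallization.Theorems.FrustratedLawDichotomyStrainedPatchHomPrunedPolar (homFloor_of_prunedBoxSums_selfAdjoint)
open Summit.AtomisticToContinuum.Crystallization.Theorems.FrustratedLawDichotomyStrainedPatchHomCertTree (CertTree treeOK)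
open Summit.AtomisticToContinuum.Crystallization.Theorems.FrustratedLawDichotomyStrainedPatchHomEntryGram (rootC rootW)
open Summit.AtomisticToContinuum.Crystallization.Theorems.FrustratedLawDichotomyStrainedPatchHomEntryGramHcp (rootCH rootWH)
open Summit.AtomisticToContinuum.Crystallization.Theorems.FrustratedLawDichotomyStrainedPatchHomEntryTable (muRec muRec_ok)
open Summit.AtomisticToContinuum.Crystallization.Theorems.FrustratedLawDichotomyStrainedPatchHomEntryTableP (entryLeafOK6RBKP)
open Summit.AtomisticToContinuum.Crystallization.Theorems.FrustratedLawDichotomyStrainedPatchHomEntryTreeCert (fccHalf_of_entryTree6RBKP)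
open Summit.AtomisticToContinuum.Crystallization.Theorems.FrustratedLawDichotomyStrainedPatchHomEntryFlipHcp (HcpDich hcpHalf_of_entryTreeShuf)
open Summit.AtomisticToContinuum.Crystallization.Theorems.FrustratedLawDichotomyStrainedPatchHomSlopeLJ (slopeGsLJ slopeCheckLJ_slopeGsLJ)
open Summit.AtomisticToContinuum.Crystallization.Theorems.FrustratedLawDichotomyStrainedPatchHomCurvLJ (naiveLJ)

/-! ## §1. Chunked slope certificate -/

/-- Slope split of a label chunk on the reference box: (centred, naive). -/
def htSl (c w : (Fin 3 × Fin 3) ⊕ Fin 3 → ℤ) (L : List (Fin 3 → ℤ)) : List (Fin 3 → ℤ) × List (Fin 3 → ℤ) :=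
  (L.filter fun b => slopeLJLabelOK c (refW w) b, L.filter fun b => !slopeLJLabelOK c (refW w) b)

/-- The naive guard of a chunk (the centred guard holds by construction). -/
def htNaiOK (c w : (Fin 3 × Fin 3) ⊕ Fin 3 → ℤ) (L : List (Fin 3 → ℤ)) : Bool :=
  (htSl c w L).2.all fun b => (naiveLJ c (refW w) b).isSome

/-- The computed slope constant of a chunk (`…HomSlopeLJ.slopeGsLJ` on the split). -/
def htGs (c w : (Fin 3 × Fin 3) ⊕ Fin 3 → ℤ) (L : List (Fin 3 → ℤ)) : ℤ := slopeGsLJ c (refW w) (htSl c w L).1 (htSl c w L).2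

/-- A filter satisfies its own predicate. [formal bookkeeping] -/
theorem all_filter_self {α : Type*} (l : List α) (p : α → Bool) : ((l.filter p).all p) = true :=
  List.all_eq_true.2 fun _ hb => (List.mem_filter.1 hb).2

/-- ★ **Per-chunk reference force bound**: for a duplicate-free chunk `L` with its naive guard, `|Σ_{L} kernel(ξ₀)⟪X, Δ⟫| ≤ (htGs/SC)‖Δ‖` at every `U` of the
entry box and every `ξ` (`ξ₀` = the ξ-centre of the cell). [folklore chaining: `…HomSlopeLJ.forceLJ_ref_bound_of_check`] -/
theorem refForce_chunk_le {c w : (Fin 3 × Fin 3) ⊕ Fin 3 → ℤ} {L : List (Fin 3 → ℤ)} (hL : L.Nodup) (hn : htNaiOK c w L = true)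
    (U : E3 →L[ℝ] E3) (hU : ‖U - 1‖ ≤ 1 / 4)
    (hbox : ∀ ab : Fin 3 × Fin 3, |(U (EuclideanSpace.single ab.2 (1 : ℝ))) ab.1 - (c (Sum.inl ab) : ℝ) / SC| ≤ (w (Sum.inl ab) : ℝ) / SC)
    (hn₀ : ‖cenShuf c‖ ≤ 1 / 4) (ξ : E3) :
    |∑ bb ∈ L.toFinset, (‖latPt U hexFrame bb + U (hcpShift + cenShuf c)‖⁻¹ ^ 8 - ‖latPt U hexFrame bb + U (hcpShift + cenShuf c)‖⁻¹ ^ 14) *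
        ⟪latPt U hexFrame bb + U (hcpShift + cenShuf c), U (ξ - cenShuf c)⟫| ≤ (htGs c w L : ℝ) / SC * ‖U (ξ - cenShuf c)‖ := by
  classical
  have hbox' : ∀ ab : Fin 3 × Fin 3, |(U (EuclideanSpace.single ab.2 (1 : ℝ))) ab.1 - (c (Sum.inl ab) : ℝ) / SC| ≤ (refW w (Sum.inl ab) : ℝ) / SC :=
    fun ab => by rw [refW_inl]; exact hbox ab
  have hξ₀' : ∀ i : Fin 3, |cenShuf c i - (c (Sum.inr i) : ℝ) / SC| ≤ (refW w (Sum.inr i) : ℝ) / SC := by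
    intro i; rw [refW_inr, cenShuf_apply, sub_self, abs_zero]; simp
  have hcheck := slopeCheckLJ_slopeGsLJ (all_filter_self L fun b => slopeLJLabelOK c (refW w) b) hn
  have key := forceLJ_ref_bound_of_check (nodup_filter_append hL fun b => slopeLJLabelOK c (refW w) b) hcheck U hU hbox' (cenShuf c) hξ₀' hn₀ ξ
  rw [toFinset_filter_append] at key
  exact key

/-- ★ **The reference force bound over `B = htB`** from the three chunk bounds: `|Σ_B| ≤ ((htGs near + htGs far₁ + htGs far₂)/SC)·‖Δ‖`. [folklore: additivity] -/
theorem refForce_htB_le {c w : (Fin 3 × Fin 3) ⊕ Fin 3 → ℤ} (h1 : htNaiOK c w (htNear c w) = true) (h2 : htNaiOK c w (htFar1 c w) = true)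
    (h3 : htNaiOK c w (htFar2 c w) = true) (U : E3 →L[ℝ] E3) (hU : ‖U - 1‖ ≤ 1 / 4)
    (hbox : ∀ ab : Fin 3 × Fin 3, |(U (EuclideanSpace.single ab.2 (1 : ℝ))) ab.1 - (c (Sum.inl ab) : ℝ) / SC| ≤ (w (Sum.inl ab) : ℝ) / SC)
    (hn₀ : ‖cenShuf c‖ ≤ 1 / 4) (ξ : E3) :
    |∑ bb ∈ (htB c w).toFinset, (‖latPt U hexFrame bb + U (hcpShift + cenShuf c)‖⁻¹ ^ 8 - ‖latPt U hexFrame bb + U (hcpShift + cenShuf c)‖⁻¹ ^ 14) *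
        ⟪latPt U hexFrame bb + U (hcpShift + cenShuf c), U (ξ - cenShuf c)⟫| ≤
      ((htGs c w (htNear c w) + htGs c w (htFar1 c w) + htGs c w (htFar2 c w) : ℤ) : ℝ) / SC * ‖U (ξ - cenShuf c)‖ := by
  classical
  have hN : (htNear c w).Nodup := boxLabels11_nodup.filter _
  have hF1 : (htFar1 c w).Nodup := boxLabels11_nodup.filter _
  have hF2 : (htFar2 c w).Nodup := boxLabels11_nodup.filter _
  have k1 := refForce_chunk_le hN h1 U hU hbox hn₀ ξ
  have k2 := refForce_chunk_le hF1 h2 U hU hbox hn₀ ξ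
  have k3 := refForce_chunk_le hF2 h3 U hU hbox hn₀ ξ
  -- `htB.toFinset = htNear.toFinset ∪ htFar1.toFinset ∪ htFar2.toFinset`, pairwise disjoint
  obtain ⟨h12, _, hd3⟩ := List.nodup_append.1 (htB_nodup c w)
  obtain ⟨_, _, hd2⟩ := List.nodup_append.1 h12
  have hd3' : List.Disjoint ((htCen c w ++ htNai c w) ++ htFar1 c w) (htFar2 c w) := fun a ha hb => hd3 a ha a hb rfl
  have hd2' : List.Disjoint (htCen c w ++ htNai c w) (htFar1 c w) := fun a ha hb => hd2 a ha a hb rfl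
  have hnear : (htCen c w ++ htNai c w).toFinset = (htNear c w).toFinset := toFinset_filter_append (htNear c w) fun b => isCenLJ c w b
  rw [htB, List.toFinset_append, Finset.sum_union (List.disjoint_toFinset_iff_disjoint.2 hd3'), List.toFinset_append,
    Finset.sum_union (List.disjoint_toFinset_iff_disjoint.2 hd2'), hnear]
  push_cast
  rw [add_div, add_div, add_mul, add_mul]
  refine (abs_add_le _ _).trans (add_le_add ((abs_add_le _ _).trans (add_le_add k1 k2)) k3)

/-! ## §2. ★ The chunked leaf and ★★★ its soundness -/

/-- ★ **THE ANALYTIC-SLAB ξ-BOX LEAF, CHUNKED SLOPE** (`htGs` computed in the kernel per chunk, their sum `≤ p.Gs`). -/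
def entryLeafOKHT3 (μ : ℤ) (p : HTCert) (c w : (Fin 3 × Fin 3) ⊕ Fin 3 → ℤ) : Bool :=
  xiBallOK c w && htROK c w && htCertOK p c w &&
    curvCheckLJM c w (htCen c w) (htNai c w) p.D p.lam₁ && forceJacCheckN c w (htFar1 c w) p.lam₂ && forceJacCheckN c w (htFar2 c w) p.lam₃ &&
    (htNaiOK c w (htNear c w) && htNaiOK c w (htFar1 c w) && htNaiOK c w (htFar2 c w)) &&
    decide (htGs c w (htNear c w) + htGs c w (htFar1 c w) + htGs c w (htFar2 c w) ≤ p.Gs) && entryLeafOKHCCX μ c (htW p c w)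

/-- ★★★ **SOUNDNESS OF `entryLeafOKHT3` IN THE hver SHAPE**: for every `U` of the entry box (self-adjoint, `‖U − 1‖ ≤ 1/4`) and every shuffle `ξ` of the
ξ-cell (wedge signs passed through), the dichotomy `Tight ∨ Exempt ∨ Bad` for every injective enumeration of the homogeneous hcp `133/10`-ball, or the
energy floor `μ/SC` — by the analytic slab: outside the slab about the cell centre `ξ₀` the centre atom is exempt (`…HomExemptZeroStep`), inside it the
shuffle is confined to the box `htW` on which `entryLeafOKHCCX μ` was certified. [folklore chaining: `…HomSlabLeaf.hver_of_slabParts`] -/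
theorem entryLeafOKHT3_sound {μ : ℤ} {p : HTCert} {c w : (Fin 3 × Fin 3) ⊕ Fin 3 → ℤ} (h : entryLeafOKHT3 μ p c w = true) (U : E3 →L[ℝ] E3) (ξ : E3)
    (hsa : ∀ v v' : E3, ⟪U v, v'⟫ = ⟪v, U v'⟫) (hU : ‖U - 1‖ ≤ 1 / 4)
    (hbox : ∀ ab : Fin 3 × Fin 3, |(U (EuclideanSpace.single ab.2 (1 : ℝ))) ab.1 - (c (Sum.inl ab) : ℝ) / SC| ≤ (w (Sum.inl ab) : ℝ) / SC)
    (hξ : ∀ i : Fin 3, |ξ i - (c (Sum.inr i) : ℝ) / SC| ≤ (w (Sum.inr i) : ℝ) / SC) (h0 : 0 ≤ ξ 0) (h2 : 0 ≤ ξ 2) :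
    (∀ (M : ℕ) (z : Fin M → E3) (cc : Fin M), Function.Injective z →
        Set.range z = {x : E3 | dist x (z cc) ≤ 133 / 10 ∧ ∃ a : Fin 3 → ℤ,
          x = z cc + latPt U hexFrame a ∨ x = z cc + latPt U hexFrame a + U (hcpShift + ξ)} →
        TightNearCap (9 / 5) (3 / 2) z cc ∨ ExemptNear (9 / 5) ExRec z cc ∨ BadNearCap (9 / 5) (3 / 2) z cc) ∨
      (μ : ℝ) / SC ≤ ∑ b ∈ (Fintype.piFinset fun _ : Fin 3 => Finset.Icc (-7 : ℤ) 7).filter (fun b => b ≠ 0), effPot w₄₅ ω₄ (3 / 400) ‖latPt U hexFrame b‖ +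
        ∑ b ∈ (Fintype.piFinset fun _ : Fin 3 => Finset.Icc (-7 : ℤ) 7), effPot w₄₅ ω₄ (3 / 400) ‖latPt U hexFrame b + U (hcpShift + ξ)‖ := by
  classical
  have hS : (0 : ℝ) < SC := by norm_num [SC]
  unfold entryLeafOKHT3 at h
  simp only [Bool.and_eq_true, decide_eq_true_eq] at h
  obtain ⟨⟨⟨⟨⟨⟨⟨⟨hball, hROK⟩, hcert⟩, hcurvM⟩, hfar1⟩, hfar2⟩, ⟨⟨hs1, hs2⟩, hs3⟩⟩, hGs⟩, hinner⟩ := h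
  obtain ⟨hT, hγ, hr, hconf⟩ := htCertOK_spec hcert
  -- the reference shuffle: the ξ-centre of the cell
  set ξ₀ : E3 := cenShuf c with hξ₀def
  have hw0 : ∀ i : Fin 3, (0 : ℝ) ≤ (w (Sum.inr i) : ℝ) / SC := fun i => (abs_nonneg _).trans (hξ i)
  have hξ₀box : ∀ i : Fin 3, |ξ₀ i - (c (Sum.inr i) : ℝ) / SC| ≤ (w (Sum.inr i) : ℝ) / SC := by
    intro i; rw [hξ₀def, cenShuf_apply, sub_self, abs_zero]; exact hw0 i
  have hn : ‖ξ‖ ≤ 1 / 4 := norm_le_quarter_of_xiBallOK hball hξ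
  have hn₀ : ‖ξ₀‖ ≤ 1 / 4 := norm_le_quarter_of_xiBallOK hball hξ₀box
  -- label finsets
  set B : Finset (Fin 3 → ℤ) := (htB c w).toFinset with hBdef
  set R : Finset (Fin 3 → ℤ) := (htR c w).toFinset with hRdef
  have hB : B ⊆ Fintype.piFinset fun _ : Fin 3 => Finset.Icc (-11 : ℤ) 11 := by
    intro b hb
    rw [← boxLabels11_toFinset]
    exact List.mem_toFinset.2 (mem_boxLabels11_of_mem_htB (List.mem_toFinset.1 hb))
  have hBin : ∀ bb ∈ B, ‖latPt U hexFrame bb + U (hcpShift + ξ)‖ ≤ 7 :=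
    fun bb hbb => norm_le_seven_of_htIn U hbox ξ hξ (htIn_of_mem_htB (List.mem_toFinset.1 hbb))
  have hR : ∀ bb ∈ (Fintype.piFinset fun _ : Fin 3 => Finset.Icc (-11 : ℤ) 11) \ B, ‖latPt U hexFrame bb + U (hcpShift + ξ)‖ ≤ 7 →
      bb ∈ R ∧ 6 ≤ ‖latPt U hexFrame bb + U (hcpShift + ξ)‖ := by
    intro bb hbb h7
    obtain ⟨hbox11, hnotB⟩ := Finset.mem_sdiff.1 hbb
    rw [← boxLabels11_toFinset] at hbox11
    have hbL : bb ∈ boxLabels11 := List.mem_toFinset.1 hbox11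
    have hlo := lo_le_of_norm_le_seven U hbox ξ hξ h7
    by_cases hin : htIn c w bb = true
    · exact absurd (List.mem_toFinset.2 (mem_htB_of_htIn hbL hin)) hnotB
    · have hmemR : bb ∈ htR c w := by
        refine List.mem_filter.2 ⟨hbL, ?_⟩
        simp only [Bool.and_eq_true, Bool.not_eq_true', decide_eq_true_eq]
        exact ⟨by simpa using hin, hlo⟩
      have h36 : 36 * (SC : ℤ) ≤ (fjQ c w bb).lo := by
        have := List.all_eq_true.1 hROK bb hmemR
        simpa using this
      exact ⟨List.mem_toFinset.2 hmemR, six_le_norm_of_lo U hbox ξ hξ h36⟩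
  -- the Q-floor along the segment
  have hcurv : ∀ s ∈ Set.Ioo (0 : ℝ) 1,
      ((p.lam₁ + p.lam₂ + p.lam₃ : ℤ) : ℝ) / SC * ‖U (ξ - ξ₀)‖ ^ 2 + ∑ i : Fin 3, ∑ j : Fin 3, (p.D i j : ℝ) / SC * ((U (ξ - ξ₀)) i * (U (ξ - ξ₀)) j) ≤
        ∑ bb ∈ B, segGd (fun x : ℝ => x⁻¹ ^ 7 - x⁻¹ ^ 13) (latPt U hexFrame bb + U (hcpShift + ξ₀)) (U (ξ - ξ₀)) s :=
    fun s hs => jac_floorM_of_three_checks (htB_nodup c w) hcurvM hfar1 hfar2 U hU hbox ξ₀ ξ hξ₀box hξ hn₀ hn hs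
  -- the reference force bound, chunked
  have hf₀ : |∑ bb ∈ B, (‖latPt U hexFrame bb + U (hcpShift + ξ₀)‖⁻¹ ^ 8 - ‖latPt U hexFrame bb + U (hcpShift + ξ₀)‖⁻¹ ^ 14) *
      ⟪latPt U hexFrame bb + U (hcpShift + ξ₀), U (ξ - ξ₀)⟫| ≤ (p.Gs : ℝ) / SC * ‖U (ξ - ξ₀)‖ := by
    have key := refForce_htB_le hs1 hs2 hs3 U hU hbox hn₀ ξ
    refine key.trans (mul_le_mul_of_nonneg_right ?_ (norm_nonneg _))
    rw [div_le_div_iff_of_pos_right hS]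
    exact_mod_cast hGs
  -- slab ⟹ confinement ⟹ the inner verdict on the confined box
  have hslab : ((p.lam₁ + p.lam₂ + p.lam₃ : ℤ) : ℝ) / SC * ‖U (ξ - ξ₀)‖ ^ 2 +
        ∑ i : Fin 3, ∑ j : Fin 3, (p.D i j : ℝ) / SC * ((U (ξ - ξ₀)) i * (U (ξ - ξ₀)) j) ≤
      ((6000 / 343 * (7 : ℝ)⁻¹ ^ 4 + 2880 / 49 * (7 : ℝ)⁻¹ ^ 5 + 10 / 7 * (7 : ℝ)⁻¹ ^ 6 + 2 * (7 : ℝ)⁻¹ ^ 7) + (p.Gs : ℝ) / SC +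
        R.card * (6 : ℝ)⁻¹ ^ 7) * ‖U (ξ - ξ₀)‖ →
      (∀ (M : ℕ) (z : Fin M → E3) (cc : Fin M), Function.Injective z →
          Set.range z = {x : E3 | dist x (z cc) ≤ 133 / 10 ∧ ∃ a : Fin 3 → ℤ,
            x = z cc + latPt U hexFrame a ∨ x = z cc + latPt U hexFrame a + U (hcpShift + ξ)} →
          TightNearCap (9 / 5) (3 / 2) z cc ∨ ExemptNear (9 / 5) ExRec z cc ∨ BadNearCap (9 / 5) (3 / 2) z cc) ∨
        (μ : ℝ) / SC ≤ ∑ b ∈ (Fintype.piFinset fun _ : Fin 3 => Finset.Icc (-7 : ℤ) 7).filter (fun b => b ≠ 0), effPot w₄₅ ω₄ (3 / 400) ‖latPt U hexFrame b‖ +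
          ∑ b ∈ (Fintype.piFinset fun _ : Fin 3 => Finset.Icc (-7 : ℤ) 7), effPot w₄₅ ω₄ (3 / 400) ‖latPt U hexFrame b + U (hcpShift + ξ)‖ := by
    intro hq
    have ht0 : (0 : ℝ) < (htT p c w : ℝ) / SC := div_pos (by exact_mod_cast hT) hS
    have hle := slabConst_le_htT p c w
    have hQ : (p.lamT : ℝ) / SC * ‖U (ξ - ξ₀)‖ ^ 2 + ∑ i : Fin 3, ∑ j : Fin 3, (p.D i j : ℝ) / SC * ((U (ξ - ξ₀)) i * (U (ξ - ξ₀)) j) ≤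
        (htT p c w : ℝ) / SC * ‖U (ξ - ξ₀)‖ := by
      have e : (p.lamT : ℝ) = ((p.lam₁ + p.lam₂ + p.lam₃ : ℤ) : ℝ) := by simp [HTCert.lamT]
      rw [e]
      exact hq.trans (mul_le_mul_of_nonneg_right hle (norm_nonneg _))
    have hΔk : ∀ k : Fin 3, |(U (ξ - ξ₀)) k| ≤ (p.rS k : ℝ) / SC := fun k =>
      abs_apply_le_of_qcert (Q := fun x : E3 => (p.lamT : ℝ) / SC * ‖x‖ ^ 2 + ∑ i : Fin 3, ∑ j : Fin 3, (p.D i j : ℝ) / SC * (x i * x j))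
        ht0 (div_pos (by exact_mod_cast hγ k) hS) (div_nonneg (by exact_mod_cast hr k) hS.le) k (fun x => htConf_sound (hconf k) x) hQ
    have hy := fun k => abs_coord_le_of_confined hU (ξ - ξ₀) (r := fun j => (p.rS j : ℝ) / SC) (κ := fun k => (htκ c w k : ℝ) / SC) hΔk
      (rowDev_le U hbox) k
    -- the confined box
    have hξ' : ∀ i : Fin 3, |ξ i - (c (Sum.inr i) : ℝ) / SC| ≤ (htW p c w (Sum.inr i) : ℝ) / SC := by
      intro i
      have hyi := hy i
      have e1 : (ξ - ξ₀) i = ξ i - (c (Sum.inr i) : ℝ) / SC := by rw [PiLp.sub_apply, hξ₀def, cenShuf_apply]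
      rw [e1] at hyi
      refine hyi.trans ?_
      rw [htW_inr]
      have hρ := sqrt_le_htρ p
      have hκ0 : (0 : ℝ) ≤ (htκ c w i : ℝ) / SC :=
        (Finset.sum_nonneg fun j _ => abs_nonneg _).trans (rowDev_le U hbox i)
      have hρ0 : (0 : ℝ) ≤ (htρ p : ℝ) := by
        have := (Real.sqrt_nonneg _).trans hρ
        rw [le_div_iff₀ hS, zero_mul] at this; exact this
      have hcd := div_le_cdiv (a := htκ c w i * 4 * htρ p) (b := 3 * (SC : ℤ)) (by norm_num [SC])
      have step : (htκ c w i : ℝ) / SC * (4 / 3 * Real.sqrt (∑ j : Fin 3, ((p.rS j : ℝ) / SC) ^ 2)) ≤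
          ((cdiv (htκ c w i * 4 * htρ p) (3 * SC) : ℤ) : ℝ) / SC := by
        have h1 : (htκ c w i : ℝ) / SC * (4 / 3 * Real.sqrt (∑ j : Fin 3, ((p.rS j : ℝ) / SC) ^ 2)) ≤
            (htκ c w i : ℝ) / SC * (4 / 3 * ((htρ p : ℝ) / SC)) := by gcongr
        refine h1.trans ?_
        rw [le_div_iff₀ hS]
        have e : (htκ c w i : ℝ) / SC * (4 / 3 * ((htρ p : ℝ) / SC)) * SC = ((htκ c w i * 4 * htρ p : ℤ) : ℝ) / ((3 * (SC : ℤ) : ℤ) : ℝ) := by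
          push_cast; field_simp
        rw [e]; exact hcd
      push_cast
      rw [add_div]
      linarith
    have hbox'' : ∀ ab : Fin 3 × Fin 3, |(U (EuclideanSpace.single ab.2 (1 : ℝ))) ab.1 - (c (Sum.inl ab) : ℝ) / SC| ≤ (htW p c w (Sum.inl ab) : ℝ) / SC :=
      fun ab => by rw [htW_inl]; exact hbox ab
    exact entryLeafOKHCCX_sound hinner U ξ hsa hU hbox'' hξ' h0 h2
  exact hver_of_slabParts hU hn₀ hn B R hB hBin hR hcurv hf₀ hslab


/-! ## §3. Booking -/

/-- ★ The chunked slab verdict with a payload function, else the union verdict of record. -/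
def entryLeafOKHT3X (μ : ℤ) (P : ((Fin 3 × Fin 3) ⊕ Fin 3 → ℤ) → ((Fin 3 × Fin 3) ⊕ Fin 3 → ℤ) → HTCert) (c w : (Fin 3 × Fin 3) ⊕ Fin 3 → ℤ) : Bool :=
  entryLeafOKHT3 μ (P c w) c w || entryLeafOKHCCX μ c w

/-- ★★ Soundness of `entryLeafOKHT3X` in the hver shape. [folklore chaining] -/
theorem entryLeafOKHT3X_sound {μ : ℤ} {P : ((Fin 3 × Fin 3) ⊕ Fin 3 → ℤ) → ((Fin 3 × Fin 3) ⊕ Fin 3 → ℤ) → HTCert}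
    {c w : (Fin 3 × Fin 3) ⊕ Fin 3 → ℤ} (h : entryLeafOKHT3X μ P c w = true) (U : E3 →L[ℝ] E3) (ξ : E3)
    (hsa : ∀ v v' : E3, ⟪U v, v'⟫ = ⟪v, U v'⟫) (hU : ‖U - 1‖ ≤ 1 / 4)
    (hbox : ∀ ab : Fin 3 × Fin 3, |(U (EuclideanSpace.single ab.2 (1 : ℝ))) ab.1 - (c (Sum.inl ab) : ℝ) / SC| ≤ (w (Sum.inl ab) : ℝ) / SC)
    (hξ : ∀ i : Fin 3, |ξ i - (c (Sum.inr i) : ℝ) / SC| ≤ (w (Sum.inr i) : ℝ) / SC) (h0 : 0 ≤ ξ 0) (h2 : 0 ≤ ξ 2) :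
    (∀ (M : ℕ) (z : Fin M → E3) (cc : Fin M), Function.Injective z →
        Set.range z = {x : E3 | dist x (z cc) ≤ 133 / 10 ∧ ∃ a : Fin 3 → ℤ,
          x = z cc + latPt U hexFrame a ∨ x = z cc + latPt U hexFrame a + U (hcpShift + ξ)} →
        TightNearCap (9 / 5) (3 / 2) z cc ∨ ExemptNear (9 / 5) ExRec z cc ∨ BadNearCap (9 / 5) (3 / 2) z cc) ∨
      (μ : ℝ) / SC ≤ ∑ b ∈ (Fintype.piFinset fun _ : Fin 3 => Finset.Icc (-7 : ℤ) 7).filter (fun b => b ≠ 0), effPot w₄₅ ω₄ (3 / 400) ‖latPt U hexFrame b‖ +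
        ∑ b ∈ (Fintype.piFinset fun _ : Fin 3 => Finset.Icc (-7 : ℤ) 7), effPot w₄₅ ω₄ (3 / 400) ‖latPt U hexFrame b + U (hcpShift + ξ)‖ := by
  simp only [entryLeafOKHT3X, Bool.or_eq_true] at h
  rcases h with h | h
  · exact entryLeafOKHT3_sound h U ξ hsa hU hbox hξ h0 h2
  · exact entryLeafOKHCCX_sound h U ξ hsa hU hbox hξ h0 h2

/-- ★★ The hcp half from ONE certificate tree over `entryLeafOKHT3X μ P`. [folklore chaining] -/
theorem hcpHalf_of_entryTreeHT3X {m : ℝ} {μ : ℤ} (hμ : 2 * (m + (-(7175 / 10000) + 3 / 400)) * SC ≤ μ)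
    (P : ((Fin 3 × Fin 3) ⊕ Fin 3 → ℤ) → ((Fin 3 × Fin 3) ⊕ Fin 3 → ℤ) → HTCert) {t : CertTree ((Fin 3 × Fin 3) ⊕ Fin 3)}
    (h : treeOK (entryLeafOKHT3X μ P) t rootCH rootWH = true) :
    ∀ (U : E3 →L[ℝ] E3) (ξ : E3), (∀ v w : E3, inner ℝ (U v) w = inner ℝ v (U w)) → (∀ w : E3, 0 ≤ inner ℝ w (U w)) →
      ‖U - 1‖ ≤ 1 / 4 → ‖ξ‖ ≤ 1 / 4 → HcpDich m U ξ :=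
  hcpHalf_of_entryTreeShuf hμ (entryLeafOKHT3X μ P) (fun _ _ hv U ξ hsa hU hbox hξ h0 h2 => entryLeafOKHT3X_sound hv U ξ hsa hU hbox hξ h0 h2) h

/-- ★★★ **`(H) HomFloor (1/625)` OVER THE CHUNKED SLAB VERDICT** (`μ = muRec`, any payload function). [folklore] -/
theorem homFloor_625_of_entryTrees6RBKP_HT3X (P : ((Fin 3 × Fin 3) ⊕ Fin 3 → ℤ) → ((Fin 3 × Fin 3) ⊕ Fin 3 → ℤ) → HTCert)
    (hF : ∃ t : CertTree (Fin 3 × Fin 3), treeOK (entryLeafOK6RBKP muRec) t rootC rootW = true)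
    (hH : ∃ t : CertTree ((Fin 3 × Fin 3) ⊕ Fin 3), treeOK (entryLeafOKHT3X muRec P) t rootCH rootWH = true) : HomFloor (1 / 625) := by
  obtain ⟨tF, htF⟩ := hF
  obtain ⟨tH, htH⟩ := hH
  exact homFloor_of_prunedBoxSums_selfAdjoint (fccHalf_of_entryTree6RBKP muRec_ok htF) (hcpHalf_of_entryTreeHT3X muRec_ok P htH)

end Summit.AtomisticToContinuum.Crystallization.Theorems.FrustratedLawDichotomyStrainedPatchHomEntryLeafHT

end
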